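import Mathlib
import Literature.Claims.NS.Silvente2025
import HarnessLib

/-!
# Solo salvage for claim C104 `Silvente2025` (cell `ns-claims`, D-0090): the local Grönwall bound is TRUE

Claim: row C104 `Silvente2025` (skeleton p488140, typist-5 g3; salvage lane salvage-p4 g2). The
adjudication targets are the scalar Grönwall steps `Step_2` (small-data global closure, p.10/p.16/App. A)
and `Step_3b` (p.11). Between them the text prints ONE correct inference, typed as
`Literature.Claims.NS.Silvente2025.Step_2loc C` ([Resonant Grönwall Estimate] p.16 l.6–14): under the
law `E′ + 2νD ≤ C·E√E` with `E, D ≥ 0`, if `0 < E(0) < 1/(C²T²)` then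
`E(t) ≤ E(0)/(1 − C t √E(0))²` for `0 ≤ t ≤ T` — a horizon-dependent bound. This file settles its exact
status in the kernel:

* `le_div_sq_of_deriv_le_mul_sqrt` — ODE comparison for `C > 0`: a differentiable `E` with
  `E′ ≤ C·E√E` on `[0,∞)` and `0 < E(0)`, `C·T·√E(0) < 1` stays below the majorant
  `B(t) = E(0)/(1 − C t √E(0))²` on `[0,T]` (`B′ = 2C·B√B > C·B√B`, Mathlib's fencing lemma
  `image_le_of_deriv_right_lt_deriv_boundary'`; the sharp majorant has `C/2`, the printed `C` is weaker);
* `step_2loc_holds : 0 ≤ C → Step_2loc C` — the typed step for every `C ≥ 0` (`C = 0` is vacuous as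
  typed: `1/(0·T²) = 0` in Mathlib, contradicting `0 < E(0) < 1/(C²T²)`);
* `not_step_2loc_of_neg : C < 0 → ¬ Step_2loc C` — degenerate-sign remark (the print's `C` is
  positive): for `C < 0` the display would assert decay FASTER than the law forces; `E(t) = e^{Ct}`,
  `D ≡ 0`, `T = t = −1/(2C)` obeys the law and has `E(t) = e^{−1/2} > 4/9 = 1/(1 − Ct)²`.

So `Step_2loc C` holds exactly for `C ≥ 0`; it is consumed by no all-time conclusion of the text (the
row's record: `Step_2`/`Step_3b` are false at their own scalar grain, `SoloRefuteSilvente2025.lean`).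

WHAT THIS IS NOT: not a claim about NS regularity or blow-up; not a claim about any author beyond the typed locator.
-/

set_option linter.dupNamespace false

noncomputable section

namespace Summit.NavierStokesRegularity.NavierStokesRegularity.Theorems.Silvente2025

open Set Real

/-! ## ODE comparison: `E′ ≤ C E^{3/2}` stays below `E(0)/(1 − C t √E(0))²` -/

/-- **Comparison lemma (C > 0).** If `E` is differentiable, `E′(t) ≤ C·E(t)√E(t)` for `t ≥ 0`,
`0 < E(0)` and `C·T·√E(0) < 1`, then `E(t) ≤ E(0)/(1 − C t √E(0))²` on `[0,T]`. The majorant `B`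
solves `B′ = 2C·B√B`, so at a touching point `E = B` one has `E′ ≤ C·B√B < B′` and Mathlib's fencing
theorem applies. [cite: Silvente2025, [Resonant Grönwall Estimate] p.16 l.6–14] -/
theorem le_div_sq_of_deriv_le_mul_sqrt {E : ℝ → ℝ} {C T : ℝ} (hC : 0 < C)
    (hdiff : Differentiable ℝ E) (hlaw : ∀ t, 0 ≤ t → deriv E t ≤ C * (E t * Real.sqrt (E t)))
    (hE0 : 0 < E 0) (hCT : C * T * Real.sqrt (E 0) < 1) :
    ∀ t ∈ Icc 0 T, E t ≤ E 0 / (1 - C * t * Real.sqrt (E 0)) ^ 2 := by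
  set e₀ : ℝ := E 0 with he₀
  set σ : ℝ := Real.sqrt e₀ with hσ
  have hσpos : 0 < σ := Real.sqrt_pos.mpr hE0
  have hCσ : 0 ≤ C * σ := by positivity
  -- the denominator is positive on `[0,T]`
  have hden : ∀ t ∈ Icc 0 T, 0 < 1 - C * t * σ := by
    intro t ht
    have h1 : C * t * σ ≤ C * T * σ := by
      have := mul_le_mul_of_nonneg_left ht.2 hCσ
      nlinarith [this]
    linarith
  -- the majorant and its derivative
  set B : ℝ → ℝ := fun t => e₀ / (1 - C * t * σ) ^ 2 with hB
  set B' : ℝ → ℝ := fun t =>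
    (0 * (1 - C * t * σ) ^ 2 - e₀ * (2 * (1 - C * t * σ) * (-(C * σ)))) / ((1 - C * t * σ) ^ 2) ^ 2
    with hB'
  have hBd : ∀ t, 1 - C * t * σ ≠ 0 → HasDerivAt B (B' t) t := by
    intro t ht
    have hg : HasDerivAt (fun s => 1 - C * s * σ) (-(C * σ)) t := by
      have h1 : HasDerivAt (fun s => C * s * σ) (C * 1 * σ) t :=
        ((hasDerivAt_id t).const_mul C).mul_const σ
      have h2 := (hasDerivAt_const t (1 : ℝ)).sub h1
      refine h2.congr_deriv ?_
      ring
    have hg2 : HasDerivAt (fun s => (1 - C * s * σ) ^ 2) (2 * (1 - C * t * σ) * (-(C * σ))) t := by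
      have h := hg.pow 2
      refine h.congr_deriv ?_
      simp [pow_one]
    exact (hasDerivAt_const t e₀).div hg2 (pow_ne_zero 2 ht)
  -- fencing
  have key := image_le_of_deriv_right_lt_deriv_boundary' (f := E) (f' := deriv E) (a := 0) (b := T)
    hdiff.continuous.continuousOn (fun x _ => (hdiff x).hasDerivAt.hasDerivWithinAt) (B := B) (B' := B')
    (by have h0 : B 0 = e₀ := by simp [hB]
        rw [h0, he₀]) (fun t ht => (hBd t (hden t ht).ne').continuousAt.continuousWithinAt)
    (fun t ht => (hBd t (hden t (Ico_subset_Icc_self ht)).ne').hasDerivWithinAt) ?_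
  · intro t ht
    simpa [hB] using key ht
  -- the strict inequality at a touching point
  intro x hx hEq
  have hd : 0 < 1 - C * x * σ := hden x (Ico_subset_Icc_self hx)
  set d : ℝ := 1 - C * x * σ with hd_def
  have hBx : B x = e₀ / d ^ 2 := by simp [hB, hd_def]
  have hsq : Real.sqrt (B x) = σ / d := by
    rw [hBx, Real.sqrt_div' _ (sq_nonneg d), Real.sqrt_sq hd.le]
  have hK : 0 < C * e₀ * σ / d ^ 3 := by positivity
  have h1 : deriv E x ≤ C * e₀ * σ / d ^ 3 := by
    have h := hlaw x hx.1
    rw [hEq, hsq, hBx] at h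
    calc deriv E x ≤ C * (e₀ / d ^ 2 * (σ / d)) := h
      _ = C * e₀ * σ / d ^ 3 := by field_simp
  have h2 : B' x = 2 * (C * e₀ * σ / d ^ 3) := by
    simp only [hB']
    rw [← hd_def]
    field_simp
    ring
  rw [h2]
  linarith

/-! ## The typed step -/

/-- **C104 salvage: `Step_2loc C` holds for every `C ≥ 0`** ([Resonant Grönwall Estimate] p.16
l.6–14, the horizon-dependent bound). From the law `E′ + 2νD ≤ C·E√E` with `D ≥ 0` one gets
`E′ ≤ C·E√E`; `E(0) < 1/(C²T²)` gives `C·T·√E(0) < 1`; then `le_div_sq_of_deriv_le_mul_sqrt`. The case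
`C = 0` is vacuous as typed (`1/(0·T²) = 0`). [cite: Silvente2025, [Resonant Grönwall Estimate] p.16 l.6–14] -/
theorem step_2loc_holds {C : ℝ} (hC : 0 ≤ C) : Literature.Claims.NS.Silvente2025.Step_2loc C := by
  intro ν hν E D hAdm hlaw T hT hE0 hsmall t ht0 htT
  rcases hC.eq_or_lt with h | h
  · subst h
    simp at hsmall
    linarith
  · have hlaw' : ∀ s, 0 ≤ s → deriv E s ≤ C * (E s * Real.sqrt (E s)) := by
      intro s hs
      have h1 := hlaw s hs
      have h2 := hAdm.nonneg_D s hs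
      nlinarith
    have hCT : C * T * Real.sqrt (E 0) < 1 := by
      have hCTpos : 0 < C * T := mul_pos h hT
      have h1 : Real.sqrt (E 0) < Real.sqrt (1 / (C ^ 2 * T ^ 2)) := Real.sqrt_lt_sqrt hE0.le hsmall
      have h2 : Real.sqrt (1 / (C ^ 2 * T ^ 2)) = 1 / (C * T) := by
        rw [show C ^ 2 * T ^ 2 = (C * T) ^ 2 by ring, Real.sqrt_div' _ (sq_nonneg _),
          Real.sqrt_sq hCTpos.le, Real.sqrt_one]
      rw [h2] at h1
      calc C * T * Real.sqrt (E 0) < C * T * (1 / (C * T)) := by gcongr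
        _ = 1 := by field_simp
    exact le_div_sq_of_deriv_le_mul_sqrt h hAdm.diff hlaw' hE0 hCT t ⟨ht0, htT⟩

/-- **Degenerate sign: `Step_2loc C` is FALSE as typed for `C < 0`** (a remark on the decl's exact
truth set, not a defect of the print, whose `C` is positive). Witness `ν = 1`, `E(t) = e^{Ct}`, `D ≡ 0`,
`T = t = −1/(2C)`: admissible, `E′ = C·E ≤ C·E√E` for `t ≥ 0` (as `√E ≤ 1` there and `C < 0`),
`E(0) = 1 < 4 = 1/(C²T²)`, but `E(t) = e^{−1/2} > 4/9 = E(0)/(1 − C t √E(0))²`.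
[cite: Silvente2025, [Resonant Grönwall Estimate] p.16 l.6–14] -/
theorem not_step_2loc_of_neg {C : ℝ} (hC : C < 0) : ¬ Literature.Claims.NS.Silvente2025.Step_2loc C := by
  intro h
  set E : ℝ → ℝ := fun t => Real.exp (C * t) with hE
  have hEd : ∀ t, HasDerivAt E (Real.exp (C * t) * (C * 1)) t := fun t =>
    ((hasDerivAt_id t).const_mul C).exp
  have hAdm : Literature.Claims.NS.Silvente2025.Admissible E (fun _ => 0) :=
    { diff := fun t => (hEd t).differentiableAt
      nonneg_E := fun t _ => (Real.exp_pos _).le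
      nonneg_D := fun _ _ => le_rfl }
  have hlaw : Literature.Claims.NS.Silvente2025.LawIneq C 1 E (fun _ => 0) := by
    intro t ht
    rw [(hEd t).deriv]
    have hEt : E t = Real.exp (C * t) := rfl
    have hle1 : Real.exp (C * t) ≤ 1 := by
      rw [Real.exp_le_one_iff]
      nlinarith
    have hsq : Real.sqrt (Real.exp (C * t)) ≤ 1 := by
      rw [show (1 : ℝ) = Real.sqrt 1 by rw [Real.sqrt_one]]
      exact Real.sqrt_le_sqrt hle1
    have hpos : 0 < Real.exp (C * t) := Real.exp_pos _
    rw [hEt]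
    nlinarith [mul_nonneg hpos.le (sub_nonneg.mpr hsq)]
  have hC0 : C ≠ 0 := hC.ne
  have hT : 0 < -1 / (2 * C) := by
    apply div_pos_of_neg_of_neg <;> linarith
  have hE0 : (0 : ℝ) < E 0 := Real.exp_pos _
  have hE0' : E 0 = 1 := by simp [hE]
  have hsmall : E 0 < 1 / (C ^ 2 * (-1 / (2 * C)) ^ 2) := by
    rw [hE0']
    have hC2 : C ^ 2 * (-1 / (2 * C)) ^ 2 = 1 / 4 := by
      field_simp
      ring
    rw [hC2]
    norm_num
  have key := h 1 one_pos E (fun _ => 0) hAdm hlaw (-1 / (2 * C)) hT hE0 hsmall (-1 / (2 * C)) hT.le le_rfl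
  rw [hE0'] at key
  have hCt : C * (-1 / (2 * C)) = -1 / 2 := by field_simp
  have hrhs : (1 : ℝ) / (1 - C * (-1 / (2 * C)) * Real.sqrt 1) ^ 2 = 4 / 9 := by
    rw [Real.sqrt_one, mul_one, hCt]
    norm_num
  have hlhs : E (-1 / (2 * C)) = Real.exp (-1 / 2) := by
    simp only [hE]
    rw [hCt]
  rw [hrhs, hlhs] at key
  -- `e^{-1/2} > 4/9` since `e^{1/2} < 9/4` (as `e < 2.72 < 81/16`)
  have hprod : Real.exp (1 / 2) * Real.exp (1 / 2) = Real.exp 1 := by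
    rw [← Real.exp_add]; norm_num
  have he1 : Real.exp 1 < 2.7182818286 := Real.exp_one_lt_d9
  have hhalf_pos : 0 < Real.exp (1 / 2) := Real.exp_pos _
  have hhalf : Real.exp (1 / 2) < 9 / 4 := by
    nlinarith [hprod, he1, hhalf_pos]
  have hinv : Real.exp (-1 / 2) = (Real.exp (1 / 2))⁻¹ := by
    rw [← Real.exp_neg]; norm_num
  rw [hinv] at key
  have : (4 : ℝ) / 9 < (Real.exp (1 / 2))⁻¹ := by
    rw [lt_inv_comm₀ (by norm_num) hhalf_pos]
    calc Real.exp (1 / 2) < 9 / 4 := hhalf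
      _ = (4 / 9)⁻¹ := by norm_num
  linarith

end Summit.NavierStokesRegularity.NavierStokesRegularity.Theorems.Silvente2025

end
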